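import Mathlib.Analysis.SpecialFunctions.Log.NegMulLog
import Literature.Computability.AlgebraicComplexity.BigCwLaserSupport
import Literature.Computability.AlgebraicComplexity.MultinomialEntropy
import Literature.Computability.AlgebraicComplexity.CoppersmithWinograd1990Proofs
import Literature.Computability.AlgebraicComplexity.BorderRankKronecker
import HarnessLib

/-!
# The level-1 laser-method bound for `CW_q`:
`H((1+β)/3, (2-2β)/3, β/3) + (ω/3)(1-β) log q ≤ log R̃(CW_q)` (CW 1990 §7; BCS 1997 §15.8) — proved

Topic `Literature/Computability/AlgebraicComplexity`.  The second application of the laser method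
theorem of Bürgisser–Clausen–Shokrollahi 1997 (Thm. 15.41) — to the Coppersmith–Winograd tensor
`CW_q ∈ (k^{q+2})^{⊗3}` with the `S₃`-invariant distribution `P(0,1,1) = P(1,0,1) = P(1,1,0) = (1-β)/3`,
`P(0,0,2) = P(0,2,0) = P(2,0,0) = β/3` (BCS p. 384; Coppersmith–Winograd 1990, §7; this is the
level-1 analysis of `CW_q` in the terminology of Alman–Duan–Vassilevska Williams–Xu–Xu–Zhou 2025,
§3.7):

> `H(β/3, (2-2β)/3, (1+β)/3) + (ω/2) (β log 1 + (1-β) log q^{2/3}) ≤ log bR(t)`   (BCS p. 384),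

i.e. `H(P₁) + (ω/3)(1-β) log q ≤ log bR(CW_q) = log(q+2)`.  PROVED here for every rational
`β = v/(u+v) ∈ [0,1)` (`u ≥ 1`, `v ≥ 0`), with entropies in nats (`Real.negMulLog`), in the
asymptotic-rank form of BCS Ex. 15.24(7) (growth hypothesis `R(CW_q^{⊗N}) = O(ρ^{(1+ε)N})`, then
`log ρ` on the right):

* `bigCw_laserBound_of_growth` — the displayed inequality with `log ρ` for any such `ρ`;
* `bigCw_laserBound` — with `ρ = q + 2` (`bR(CW_q) ≤ q + 2`, `BigCoppersmithWinograd.lean`, and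
  BCS Lemma (15.27), `BorderRankKronecker.lean`): for `q ≥ 2`, `u ≥ 1`,
  `η((u+2v)/(3(u+v))) + η(2u/(3(u+v))) + η(v/(3(u+v))) + (ω/3)·(u/(u+v))·log q ≤ log(q+2)`,
  `η(x) = -x log x`.

The numerical corollary `ω < 2.39` (BCS Cor. 15.45; CW 1990 §7: `ω < 2.388`) is derived in
`BigCwOmegaBound.lean`.  Proof (restriction-only, as for the little tensor in
`CoppersmithWinograd1990Proofs.lean`): for `m ≥ 1`, `a = um`, `b = vm`, `N = 3(u+v)m`,
`CW_q^{⊗N} ≥ ⟨p_m⟩ ⊗ ⟨q^a, q^a, q^a⟩` with `binom(N; a+2b, 2a, b) rothNumberNat(3f) ≤ 288 f p_m`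
(`exists_restrictsTo_bigCw_kroneckerPow`, `BigCwLaserSupport.lean`); `binom ≥ e^{N H(P₁)}/(N+1)³`
(`MultinomialEntropy.lean`), Behrend; the rank step of the asymptotic sum inequality
(`TensorRestrictionRank.lean`); `m → ∞`, `δ, ε → 0`.  No definitions, no named facts.

## References

* D. Coppersmith, S. Winograd, *Matrix multiplication via arithmetic progressions*, J. Symbolic
  Comput. 9 (1990) 251–280, §7 ("For `q = 6`, `β ≈ 0.048`, we find `ω ≤ 3τ < 2.38719`").
  [CoppersmithWinograd1990]
* P. Bürgisser, M. Clausen, M. A. Shokrollahi, *Algebraic Complexity Theory* (1997), Thm. 15.41,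
  p. 384 (second application), Cor. 15.45, Ex. 15.24(7). [BurgisserClausenShokrollahi1997]
* J. Alman, R. Duan, V. Vassilevska Williams, Y. Xu, Z. Xu, R. Zhou, SODA 2025 = arXiv:2404.16349,
  §3.7 (level-1 partition of `CW_q`). [AlmanDuanVassilevskaWilliamsXuXuZhou2025]
-/

noncomputable section

open scoped BigOperators
open Filter Asymptotics Finset Real Topology

namespace Literature.Computability.AlgebraicComplexity

open Literature.Barriers.MatrixMultiplication (bigCwTensor)

/-! ## Elementary estimates -/

section Estimates

/-- The marginal entropy `H(P₁) = η((u+2v)/(3(u+v))) + η(2u/(3(u+v))) + η(v/(3(u+v)))` is positive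
for `u ≥ 1` (its middle term is). [folklore] -/
theorem laserEntropy_pos (u v : ℕ) (hu : 1 ≤ u) :
    0 < negMulLog (((u : ℝ) + 2 * v) / (3 * ((u : ℝ) + v))) + negMulLog ((2 * (u : ℝ)) / (3 * ((u : ℝ) + v))) +
      negMulLog ((v : ℝ) / (3 * ((u : ℝ) + v))) := by
  have hu' : (1 : ℝ) ≤ u := by exact_mod_cast hu
  have hv' : (0 : ℝ) ≤ v := Nat.cast_nonneg _
  have hK : (0 : ℝ) < 3 * ((u : ℝ) + v) := by positivity
  have h1 : 0 ≤ negMulLog (((u : ℝ) + 2 * v) / (3 * ((u : ℝ) + v))) :=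
    negMulLog_nonneg (by positivity) (by rw [div_le_one hK]; linarith)
  have h3 : 0 ≤ negMulLog ((v : ℝ) / (3 * ((u : ℝ) + v))) :=
    negMulLog_nonneg (by positivity) (by rw [div_le_one hK]; linarith)
  have hx0 : 0 < (2 * (u : ℝ)) / (3 * ((u : ℝ) + v)) := by positivity
  have hx1 : (2 * (u : ℝ)) / (3 * ((u : ℝ) + v)) < 1 := by rw [div_lt_one hK]; linarith
  have h2 : 0 < negMulLog ((2 * (u : ℝ)) / (3 * ((u : ℝ) + v))) := by
    rw [negMulLog, neg_mul, neg_pos]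
    exact mul_neg_of_pos_of_neg hx0 (Real.log_neg hx0 hx1)
  linarith

/-- Crude size of the fibre bound: `C(2a,a) C(a+2b,a) C(2b,b) ≤ 4^{3a+3b}`. [folklore] -/
theorem laserFibre_le_pow (a b : ℕ) :
    ((2 * a).choose a * ((a + 2 * b).choose a * (2 * b).choose b) : ℝ) ≤ 4 ^ (3 * a + 3 * b) := by
  have h1 : (2 * a).choose a ≤ 2 ^ (2 * a) := Nat.choose_le_two_pow _ _
  have h2 : (a + 2 * b).choose a ≤ 2 ^ (a + 2 * b) := Nat.choose_le_two_pow _ _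
  have h3 : (2 * b).choose b ≤ 2 ^ (2 * b) := Nat.choose_le_two_pow _ _
  have h : (2 * a).choose a * ((a + 2 * b).choose a * (2 * b).choose b) ≤ 4 ^ (3 * a + 3 * b) :=
    calc (2 * a).choose a * ((a + 2 * b).choose a * (2 * b).choose b)
        ≤ 2 ^ (2 * a) * (2 ^ (a + 2 * b) * 2 ^ (2 * b)) :=
          Nat.mul_le_mul h1 (Nat.mul_le_mul h2 h3)
      _ = 2 ^ (3 * a + 4 * b) := by rw [← pow_add, ← pow_add]; congr 1; ring
      _ ≤ 2 ^ (2 * (3 * a + 3 * b)) := Nat.pow_le_pow_right (by norm_num) (by omega)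
      _ = 4 ^ (3 * a + 3 * b) := by rw [pow_mul]; norm_num
  exact_mod_cast h


/-- **The diagonal is large**: from `binom(N; a+2b, 2a, b) · rothNumberNat(3f) ≤ 288 f p`
(`exists_restrictsTo_bigCw_kroneckerPow`), Behrend's bound and the entropy bound for multinomial
coefficients, `log p ≥ N · H(k/N) - 20 √N - log 96` with `N = 3a + 3b`, `k = (a+2b, 2a, b)`
(BCS (B) and (15.40): `|Δ| ≥ C binom(N, μ)`, `(1/N) log binom(N, μ) → H(P₁)`).
[cite: BurgisserClausenShokrollahi1997, Thm. 15.41 (proof, (B) and (E))] -/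
theorem log_laserDiagonal_lower {a b p : ℕ} (ha : 1 ≤ a)
    (hsize : Nat.multinomial univ ![a + 2 * b, 2 * a, b] *
        rothNumberNat (3 * ((2 * a).choose a * ((a + 2 * b).choose a * (2 * b).choose b))) ≤
      288 * ((2 * a).choose a * ((a + 2 * b).choose a * (2 * b).choose b)) * p) :
    0 < (p : ℝ) ∧
      ((3 * a + 3 * b : ℕ) : ℝ) * (∑ i, negMulLog (((![a + 2 * b, 2 * a, b] : Fin 3 → ℕ) i : ℝ) /
          ((3 * a + 3 * b : ℕ) : ℝ))) - 20 * √((3 * a + 3 * b : ℕ) : ℝ) - Real.log 96 ≤ Real.log p := by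
  -- notation, made opaque
  obtain ⟨N, hN⟩ : ∃ N : ℕ, N = 3 * a + 3 * b := ⟨_, rfl⟩
  obtain ⟨f, hf⟩ : ∃ f : ℕ, f = (2 * a).choose a * ((a + 2 * b).choose a * (2 * b).choose b) := ⟨_, rfl⟩
  obtain ⟨k, hk⟩ : ∃ k : Fin 3 → ℕ, k = ![a + 2 * b, 2 * a, b] := ⟨_, rfl⟩
  obtain ⟨C, hC⟩ : ∃ C : ℕ, C = Nat.multinomial univ k := ⟨_, rfl⟩
  rw [← hf, ← hk, ← hC] at hsize
  rw [← hN, ← hk]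
  have hN1 : 1 ≤ N := by omega
  have hN1' : (1 : ℝ) ≤ N := by exact_mod_cast hN1
  have hN0 : (0 : ℝ) < N := by linarith
  have hf1 : 1 ≤ f := by
    rw [hf]
    exact Nat.mul_pos (Nat.choose_pos (by omega))
      (Nat.mul_pos (Nat.choose_pos (by omega)) (Nat.choose_pos (by omega)))
  have hf0 : (0 : ℝ) < f := by exact_mod_cast hf1
  have hf4 : (f : ℝ) ≤ 4 ^ N := by rw [hf, hN]; push_cast; exact laserFibre_le_pow a b
  have hksum : ∑ i, k i = N := by
    rw [hk, hN, Fin.sum_univ_three]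
    simp only [Matrix.cons_val_zero, Matrix.cons_val_one, Matrix.cons_val_two, Matrix.head_cons,
      Matrix.tail_cons]
    ring
  have hC0 : (0 : ℝ) < C := by rw [hC]; exact_mod_cast Nat.multinomial_pos _ _
  have hsize' : (C : ℝ) * rothNumberNat (3 * f) ≤ 288 * f * p := by exact_mod_cast hsize
  have hlog3 : Real.log 3 ≤ 2 := by
    rw [Real.log_le_iff_le_exp (by norm_num)]; linarith [exp_two_gt]
  have hlog4 : Real.log 4 ≤ 2 := by
    rw [Real.log_le_iff_le_exp (by norm_num)]; linarith [exp_two_gt]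
  -- Behrend
  obtain ⟨s, hs⟩ : ∃ s : ℝ, s = 4 * √(Real.log ((3 * f : ℕ) : ℝ)) := ⟨_, rfl⟩
  have hexp : 0 < Real.exp (-s) := Real.exp_pos _
  have hB' : ((3 * f : ℕ) : ℝ) * Real.exp (-s) ≤ rothNumberNat (3 * f) := by
    rw [hs, show -(4 * √(Real.log ((3 * f : ℕ) : ℝ))) = -4 * √(Real.log ((3 * f : ℕ) : ℝ)) by ring]
    exact Behrend.roth_lower_bound
  -- `C e^{-s} ≤ 96 p`
  have h1 : (C : ℝ) * Real.exp (-s) ≤ 96 * p := by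
    have h3f : (0 : ℝ) < ((3 * f : ℕ) : ℝ) := by positivity
    refine le_of_mul_le_mul_right ?_ h3f
    calc (C : ℝ) * Real.exp (-s) * ((3 * f : ℕ) : ℝ)
        = (C : ℝ) * (((3 * f : ℕ) : ℝ) * Real.exp (-s)) := by ring
      _ ≤ (C : ℝ) * rothNumberNat (3 * f) := mul_le_mul_of_nonneg_left hB' hC0.le
      _ ≤ 288 * f * p := hsize'
      _ = 96 * p * ((3 * f : ℕ) : ℝ) := by push_cast; ring
  have hp0 : 0 < (p : ℝ) := by
    have : 0 < (C : ℝ) * Real.exp (-s) := mul_pos hC0 hexp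
    linarith
  refine ⟨hp0, ?_⟩
  -- the entropy bound `exp(N H) ≤ (N+1)³ C`
  have hent : Real.exp ((N : ℝ) * ∑ i, negMulLog ((k i : ℝ) / N)) ≤ ((N : ℝ) + 1) ^ 3 * C := by
    have he := exp_mul_sum_negMulLog_le_mul_multinomial k hksum
    rw [Fintype.card_fin, ← hC] at he
    exact he
  -- `exp(N H) e^{-s} ≤ 96 (N+1)³ p`, then logarithms
  have h2 : Real.exp ((N : ℝ) * ∑ i, negMulLog ((k i : ℝ) / N)) * Real.exp (-s) ≤
      96 * ((N : ℝ) + 1) ^ 3 * p := by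
    calc Real.exp ((N : ℝ) * ∑ i, negMulLog ((k i : ℝ) / N)) * Real.exp (-s)
        ≤ ((N : ℝ) + 1) ^ 3 * C * Real.exp (-s) := mul_le_mul_of_nonneg_right hent hexp.le
      _ = ((N : ℝ) + 1) ^ 3 * ((C : ℝ) * Real.exp (-s)) := by ring
      _ ≤ ((N : ℝ) + 1) ^ 3 * (96 * p) := mul_le_mul_of_nonneg_left h1 (by positivity)
      _ = 96 * ((N : ℝ) + 1) ^ 3 * p := by ring
  have h3 : (N : ℝ) * (∑ i, negMulLog ((k i : ℝ) / N)) - s ≤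
      Real.log 96 + 3 * Real.log ((N : ℝ) + 1) + Real.log p := by
    have hlhs : Real.log (Real.exp ((N : ℝ) * ∑ i, negMulLog ((k i : ℝ) / N)) * Real.exp (-s)) =
        N * (∑ i, negMulLog ((k i : ℝ) / N)) - s := by
      rw [Real.log_mul (Real.exp_pos _).ne' hexp.ne', Real.log_exp, Real.log_exp]; ring
    have hrhs : Real.log (96 * ((N : ℝ) + 1) ^ 3 * p) =
        Real.log 96 + 3 * Real.log ((N : ℝ) + 1) + Real.log p := by
      rw [Real.log_mul (by positivity) hp0.ne', Real.log_mul (by norm_num) (by positivity),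
        Real.log_pow]; push_cast; ring
    rw [← hlhs, ← hrhs]
    exact Real.log_le_log (by positivity) h2
  -- `s ≤ 8 √N` and `3 log (N+1) ≤ 12 √N`
  have h4N : √(4 * (N : ℝ)) = 2 * √(N : ℝ) := by
    rw [Real.sqrt_mul (by norm_num), show (4 : ℝ) = 2 ^ 2 by norm_num, Real.sqrt_sq (by norm_num)]
  have hs8 : s ≤ 8 * √(N : ℝ) := by
    have hlog3f : Real.log ((3 * f : ℕ) : ℝ) ≤ 4 * N := by
      have : ((3 * f : ℕ) : ℝ) ≤ 3 * 4 ^ N := by push_cast; linarith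
      calc Real.log ((3 * f : ℕ) : ℝ) ≤ Real.log (3 * 4 ^ N) :=
            Real.log_le_log (by positivity) this
        _ = Real.log 3 + N * Real.log 4 := by
            rw [Real.log_mul (by norm_num) (by positivity), Real.log_pow]
        _ ≤ 2 + N * 2 := by nlinarith
        _ ≤ 4 * N := by linarith
    have : √(Real.log ((3 * f : ℕ) : ℝ)) ≤ 2 * √(N : ℝ) := by
      rw [← h4N]; exact Real.sqrt_le_sqrt hlog3f
    rw [hs]; linarith
  have hl12 : 3 * Real.log ((N : ℝ) + 1) ≤ 12 * √(N : ℝ) := by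
    have hsq : √((N : ℝ) + 1) ≤ √(4 * N) := Real.sqrt_le_sqrt (by linarith)
    have := log_le_two_mul_sqrt (show (0 : ℝ) < N + 1 by positivity)
    rw [h4N] at hsq
    linarith
  linarith

end Estimates

/-! ## The bound -/

section Main

set_option maxHeartbeats 1000000 in
/-- **Level-1 laser-method bound for `CW_q`, growth form** (BCS Thm. 15.41 applied to `CW_q` with the
`S₃`-invariant distribution of p. 384, in the asymptotic-rank form of Ex. 15.24(7); CW 1990 §7): for
`q ≥ 2`, `ρ > 0` with `R(CW_q^{⊗N}) = O(ρ^{(1+ε)N})` for every `ε > 0`, and `u ≥ 1`, `v ≥ 0`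
(`β = v/(u+v)`):
`η((u+2v)/(3(u+v))) + η(2u/(3(u+v))) + η(v/(3(u+v))) + (ω/3)(u/(u+v)) log q ≤ log ρ`, i.e.
`H((1+β)/3, (2-2β)/3, β/3) + (ω/3)(1-β) log q ≤ log ρ` (natural logarithms, `η = negMulLog`).
[cite: BurgisserClausenShokrollahi1997, Thm. 15.41 and p. 384] -/
theorem bigCw_laserBound_of_growth (q : ℕ) (hq : 2 ≤ q) {ρ : ℝ} (hρ : 0 < ρ)
    (hyp : ∀ ε : ℝ, 0 < ε →
      (fun N : ℕ => (tensorRank (kroneckerPow (bigCwTensor ℂ q) N) : ℝ)) =O[atTop]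
        fun N : ℕ => ρ ^ ((1 + ε) * N))
    (u v : ℕ) (hu : 1 ≤ u) :
    negMulLog (((u : ℝ) + 2 * v) / (3 * ((u : ℝ) + v))) + negMulLog ((2 * (u : ℝ)) / (3 * ((u : ℝ) + v))) +
        negMulLog ((v : ℝ) / (3 * ((u : ℝ) + v))) +
      omega ℂ / 3 * ((u : ℝ) / ((u : ℝ) + v)) * Real.log q ≤ Real.log ρ := by
  have hq1 : (1 : ℝ) < q := by exact_mod_cast hq
  have hq0 : (0 : ℝ) < q := by positivity
  have hlogq : 0 < Real.log q := Real.log_pos hq1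
  have hω2 : 2 ≤ omega ℂ := omega_two_le ℂ
  have hω0 : 0 < omega ℂ := by linarith
  have hu' : (1 : ℝ) ≤ u := by exact_mod_cast hu
  have hv' : (0 : ℝ) ≤ v := Nat.cast_nonneg _
  -- the entropy `h = H(P₁)` and `K = 3(u+v)`, `L = K h`
  set h : ℝ := negMulLog (((u : ℝ) + 2 * v) / (3 * ((u : ℝ) + v))) +
    negMulLog ((2 * (u : ℝ)) / (3 * ((u : ℝ) + v))) + negMulLog ((v : ℝ) / (3 * ((u : ℝ) + v))) with hh
  have hh0 : 0 < h := laserEntropy_pos u v hu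
  set K : ℝ := 3 * ((u : ℝ) + v) with hK
  have hK0 : 0 < K := by positivity
  have hK3 : 3 ≤ K := by rw [hK]; linarith
  set L : ℝ := K * h with hL
  have hL0 : 0 < L := mul_pos hK0 hh0
  -- MAIN CLAIM: for all `ε, δ > 0`, `ω L/(ω+δ) + ω u log q ≤ (1+ε) K log ρ`
  have main : ∀ ε : ℝ, 0 < ε → ∀ δ : ℝ, 0 < δ →
      omega ℂ * (L / (omega ℂ + δ)) + omega ℂ * u * Real.log q ≤ (1 + ε) * K * Real.log ρ := by
    intro ε hε δ hδ
    have hωδ : 0 < omega ℂ + δ := by linarith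
    -- the constant of the hypothesis
    obtain ⟨Cε, hCε, hb⟩ := bound_of_isBigO_nat_atTop (hyp ε hε)
    have hrank : ∀ N : ℕ, (tensorRank (kroneckerPow (bigCwTensor ℂ q) N) : ℝ) ≤
        Cε * ρ ^ ((1 + ε) * N) := by
      intro N
      have hg : ρ ^ ((1 + ε) * N) ≠ 0 := (Real.rpow_pos_of_pos hρ _).ne'
      have := hb hg
      rwa [Real.norm_of_nonneg (Nat.cast_nonneg _),
        Real.norm_of_nonneg (Real.rpow_pos_of_pos hρ _).le] at this
    -- `ω` is an exponent
    obtain ⟨Cδ, hCδ, hCδb⟩ := exists_tensorRank_matMulTensor_le_rpow ℂ hδ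
    -- the restrictions `CW_q^{⊗3(u+v)m} ≥ ⟨P m⟩ ⊗ ⟨q^{um},q^{um},q^{um}⟩`
    have hP : ∀ m : ℕ, ∃ p : ℕ,
        Nat.multinomial univ ![u * m + 2 * (v * m), 2 * (u * m), v * m] *
            rothNumberNat (3 * ((2 * (u * m)).choose (u * m) *
              (((u * m) + 2 * (v * m)).choose (u * m) * (2 * (v * m)).choose (v * m)))) ≤
          288 * ((2 * (u * m)).choose (u * m) *
              (((u * m) + 2 * (v * m)).choose (u * m) * (2 * (v * m)).choose (v * m))) * p ∧
        TensorRestrictsTo (kroneckerPow (bigCwTensor ℂ q) (3 * (u * m) + 3 * (v * m)))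
          (kroneckerTensor (unitTensor ℂ p)
            (matMulTensor ℂ (q ^ (u * m)) (q ^ (u * m)) (q ^ (u * m)))) :=
      fun m => exists_restrictsTo_bigCw_kroneckerPow ℂ q (u * m) (v * m)
    choose P hPsize hPres using hP
    -- (E3) `log (P m) ≥ m L - 20 √K √m - log 96` for `m ≥ 1`
    have hE3 : ∀ m : ℕ, 1 ≤ m → 0 < (P m : ℝ) ∧
        (m : ℝ) * L - 20 * √K * √(m : ℝ) - Real.log 96 ≤ Real.log (P m) := by
      intro m hm
      have hm0 : (0 : ℝ) < m := by exact_mod_cast (by omega : 0 < m)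
      have hum : 1 ≤ u * m := Nat.mul_pos (by omega) (by omega)
      obtain ⟨hP0, hlow⟩ := log_laserDiagonal_lower (a := u * m) (b := v * m) hum (hPsize m)
      refine ⟨hP0, ?_⟩
      -- identify `N = K m` and the entropy sum with `h`
      have hNK : (((3 * (u * m) + 3 * (v * m) : ℕ)) : ℝ) = K * m := by rw [hK]; push_cast; ring
      have hNr : (((3 * (u * m) + 3 * (v * m) : ℕ)) : ℝ) = 3 * (((u : ℝ) + v) * m) := by
        push_cast; ring
      have huv : (0 : ℝ) < (u : ℝ) + v := by linarith
      have hratio : ∑ i, negMulLog ((((![u * m + 2 * (v * m), 2 * (u * m), v * m] : Fin 3 → ℕ) i : ℕ) : ℝ) /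
          (((3 * (u * m) + 3 * (v * m) : ℕ)) : ℝ)) = h := by
        rw [Fin.sum_univ_three]
        simp only [Matrix.cons_val_zero, Matrix.cons_val_one, Matrix.cons_val_two, Matrix.head_cons,
          Matrix.tail_cons]
        have e0 : (((u * m + 2 * (v * m) : ℕ)) : ℝ) / (((3 * (u * m) + 3 * (v * m) : ℕ)) : ℝ) =
            ((u : ℝ) + 2 * v) / (3 * ((u : ℝ) + v)) := by
          rw [hNr]; push_cast; field_simp
        have e1 : (((2 * (u * m) : ℕ)) : ℝ) / (((3 * (u * m) + 3 * (v * m) : ℕ)) : ℝ) =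
            (2 * (u : ℝ)) / (3 * ((u : ℝ) + v)) := by
          rw [hNr]; push_cast; field_simp
        have e2 : (((v * m : ℕ)) : ℝ) / (((3 * (u * m) + 3 * (v * m) : ℕ)) : ℝ) =
            (v : ℝ) / (3 * ((u : ℝ) + v)) := by
          rw [hNr]; push_cast; field_simp
        rw [e0, e1, e2]
      have hsqrt : √((((3 * (u * m) + 3 * (v * m) : ℕ)) : ℝ)) = √K * √(m : ℝ) := by
        rw [hNK, Real.sqrt_mul hK0.le]
      rw [hratio, hsqrt, hNK] at hlow
      have : K * m * h = m * L := by rw [hL]; ring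
      rw [this] at hlow
      linarith
    -- the threshold beyond which `P m / Cδ ≥ 2^{ω+δ}`
    obtain ⟨m₁, hm₁⟩ := exists_nat_forall_sqrt_le (20 * √K)
      (Real.log 96 + Real.log Cδ + (omega ℂ + δ) * Real.log 2) L hL0
    -- the inequality for large `m`
    refine le_of_forall_large_mul_le (c := 20 * √K * (omega ℂ / (omega ℂ + δ)))
      (c' := omega ℂ / (omega ℂ + δ) * (Real.log 96 + Real.log Cδ) + omega ℂ * Real.log 2 +
        Real.log Cε) ⟨max m₁ 1, fun m hm => ?_⟩
    have hm1 : 1 ≤ m := le_trans (le_max_right _ _) hm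
    have hmm₁ : m₁ ≤ m := le_trans (le_max_left _ _) hm
    have hm0 : (0 : ℝ) < m := by exact_mod_cast (by omega : 0 < m)
    obtain ⟨hP0, hlogP⟩ := hE3 m hm1
    have hthr := hm₁ m hmm₁
    -- `X = (P/Cδ)^{1/(ω+δ)} ≥ 2`
    set X : ℝ := ((P m : ℝ) / Cδ) ^ (omega ℂ + δ)⁻¹ with hX
    have hPC : 0 < (P m : ℝ) / Cδ := div_pos hP0 hCδ
    have hX0 : 0 ≤ X := Real.rpow_nonneg hPC.le _
    have hlogX : Real.log X = (Real.log (P m) - Real.log Cδ) / (omega ℂ + δ) := by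
      rw [hX, Real.log_rpow hPC, Real.log_div hP0.ne' hCδ.ne']; ring
    have hX2 : 2 ≤ X := by
      have h2 : (2 : ℝ) ^ (omega ℂ + δ) ≤ (P m : ℝ) / Cδ := by
        rw [← Real.log_le_log_iff (by positivity) hPC, Real.log_rpow (by norm_num),
          Real.log_div hP0.ne' hCδ.ne']
        linarith
      calc (2 : ℝ) = ((2 : ℝ) ^ (omega ℂ + δ)) ^ (omega ℂ + δ)⁻¹ :=
          (Real.rpow_rpow_inv (by norm_num) hωδ.ne').symm
        _ ≤ X := Real.rpow_le_rpow (by positivity) h2 (inv_nonneg.2 hωδ.le)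
    -- `A = ⌊X⌋`
    set A : ℕ := ⌊X⌋₊ with hA
    have hA2 : 2 ≤ A := Nat.le_floor (by exact_mod_cast hX2)
    have hAX : (A : ℝ) ≤ X := Nat.floor_le hX0
    have hAX' : X / 2 ≤ A := by have := Nat.lt_floor_add_one X; linarith
    have hA0 : (0 : ℝ) < A := by exact_mod_cast (by omega : 0 < A)
    -- `R(⟨A,A,A⟩) ≤ P m`
    have hap : tensorRank (matMulTensor ℂ A A A) ≤ P m := by
      have h1 := hCδb A (by omega)
      have h2 : (A : ℝ) ^ (omega ℂ + δ) ≤ X ^ (omega ℂ + δ) :=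
        Real.rpow_le_rpow hA0.le hAX hωδ.le
      have h3 : X ^ (omega ℂ + δ) = (P m : ℝ) / Cδ := by
        rw [hX]; exact Real.rpow_inv_rpow hPC.le hωδ.ne'
      have h4 : (tensorRank (matMulTensor ℂ A A A) : ℝ) ≤ P m := by
        calc (tensorRank (matMulTensor ℂ A A A) : ℝ) ≤ Cδ * (A : ℝ) ^ (omega ℂ + δ) := h1
          _ ≤ Cδ * X ^ (omega ℂ + δ) := mul_le_mul_of_nonneg_left h2 hCδ.le
          _ = P m := by rw [h3]; field_simp
      exact_mod_cast h4
    -- (E1) `(A q^{um})^ω ≤ Cε ρ^{(1+ε) N}`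
    have hum : 1 ≤ u * m := Nat.mul_pos (by omega) (by omega)
    have hqm : (2 : ℕ) ≤ q ^ (u * m) := le_trans hq (Nat.le_self_pow (by omega) q)
    have haq : 2 ≤ A * q ^ (u * m) := le_trans hqm (Nat.le_mul_of_pos_left _ (by omega))
    have hE1 := (rpow_omega_mul_le_tensorRank_of_restrictsTo ℂ _ (hPres m) hap haq).trans
      (hrank (3 * (u * m) + 3 * (v * m)))
    have haq0 : (0 : ℝ) < (A : ℝ) * (q : ℝ) ^ (u * m) := by positivity
    have hNK : (((3 * (u * m) + 3 * (v * m) : ℕ) : ℝ)) = K * m := by rw [hK]; push_cast; ring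
    have hE1' : omega ℂ * (Real.log A + (u * m : ℕ) * Real.log q) ≤
        Real.log Cε + (1 + ε) * (K * m) * Real.log ρ := by
      have hl := Real.log_le_log (Real.rpow_pos_of_pos (by positivity) _) hE1
      rw [Real.log_rpow (by positivity), Real.log_mul hCε.ne' (Real.rpow_pos_of_pos hρ _).ne',
        Real.log_rpow hρ, hNK] at hl
      have : Real.log (((A * q ^ (u * m) : ℕ) : ℝ)) = Real.log A + (u * m : ℕ) * Real.log q := by
        push_cast
        rw [Real.log_mul hA0.ne' (by positivity), Real.log_pow]; push_cast; ring
      rw [this] at hl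
      linarith
    -- (E2) `log A ≥ log X - log 2`
    have hE2 : Real.log X - Real.log 2 ≤ Real.log A := by
      have := Real.log_le_log (by linarith) hAX'
      rwa [Real.log_div (by linarith) (by norm_num)] at this
    -- combine
    have hκ : 0 < omega ℂ / (omega ℂ + δ) := div_pos hω0 hωδ
    have hcomb : omega ℂ * ((m * L - 20 * √K * √(m : ℝ) - Real.log 96 - Real.log Cδ) / (omega ℂ + δ)
        - Real.log 2) + omega ℂ * ((u * m : ℕ) * Real.log q) ≤
        Real.log Cε + (1 + ε) * K * Real.log ρ * m := by
      have h1 : (m * L - 20 * √K * √(m : ℝ) - Real.log 96 - Real.log Cδ) / (omega ℂ + δ) ≤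
          Real.log X := by
        rw [hlogX]
        exact div_le_div_of_nonneg_right (by linarith) hωδ.le
      have h2 : omega ℂ * ((m * L - 20 * √K * √(m : ℝ) - Real.log 96 - Real.log Cδ) / (omega ℂ + δ)
          - Real.log 2) ≤ omega ℂ * Real.log A :=
        mul_le_mul_of_nonneg_left (by linarith) hω0.le
      linarith [hE1', h2]
    have e1 : omega ℂ * ((m * L - 20 * √K * √(m : ℝ) - Real.log 96 - Real.log Cδ) / (omega ℂ + δ)
        - Real.log 2) + omega ℂ * ((u * m : ℕ) * Real.log q) =
        (omega ℂ * (L / (omega ℂ + δ)) + omega ℂ * u * Real.log q) * m -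
        (20 * √K * (omega ℂ / (omega ℂ + δ)) * √(m : ℝ) +
          (omega ℂ / (omega ℂ + δ) * (Real.log 96 + Real.log Cδ) + omega ℂ * Real.log 2)) := by
      push_cast
      field_simp
      ring
    rw [e1] at hcomb
    linarith
  -- from the main claim: `L - (L/2) δ + ω u log q ≤ (1+ε) K log ρ`
  have main' : ∀ ε : ℝ, 0 < ε → ∀ δ : ℝ, 0 < δ →
      L - L / 2 * δ + omega ℂ * u * Real.log q ≤ (1 + ε) * K * Real.log ρ := by
    intro ε hε δ hδ
    have hmain := main ε hε δ hδ
    have hωδ : 0 < omega ℂ + δ := by linarith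
    -- `L - ω L/(ω+δ) = L δ/(ω+δ) ≤ L δ / 2`
    have h1 : L - L / 2 * δ ≤ omega ℂ * (L / (omega ℂ + δ)) := by
      rw [mul_div_assoc', le_div_iff₀ hωδ]
      have e : (L - L / 2 * δ) * (omega ℂ + δ) =
          omega ℂ * L - L * δ * ((omega ℂ - 2) / 2) - L * δ * δ / 2 := by ring
      have n1 : 0 ≤ L * δ * ((omega ℂ - 2) / 2) :=
        mul_nonneg (mul_nonneg hL0.le hδ.le) (by linarith)
      have n2 : 0 ≤ L * δ * δ / 2 := by positivity
      rw [e]; linarith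
    linarith
  -- `L + ω u log q ≤ K log ρ`
  have key : L + omega ℂ * u * Real.log q ≤ K * Real.log ρ := by
    refine le_of_forall_pos_le_add fun η hη => ?_
    set ε : ℝ := η / (2 * (K * |Real.log ρ| + 1)) with hε
    have hε0 : 0 < ε := by positivity
    set δ : ℝ := η / (L + 1) with hδ
    have hδ0 : 0 < δ := by positivity
    have hmain := main' ε hε0 δ hδ0
    have h1 : ε * K * Real.log ρ ≤ η / 2 := by
      calc ε * K * Real.log ρ ≤ ε * K * |Real.log ρ| :=
            mul_le_mul_of_nonneg_left (le_abs_self _) (by positivity)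
        _ = η / 2 * (K * |Real.log ρ| / (K * |Real.log ρ| + 1)) := by rw [hε]; field_simp
        _ ≤ η / 2 * 1 := by
            refine mul_le_mul_of_nonneg_left ?_ (by positivity)
            rw [div_le_one (by positivity)]; linarith
        _ = η / 2 := mul_one _
    have h2 : L / 2 * δ ≤ η / 2 := by
      rw [hδ]
      rw [div_mul_eq_mul_div, mul_div_assoc]
      have : L * (η / (L + 1)) ≤ η := by
        rw [mul_div_assoc', div_le_iff₀ (by linarith)]; nlinarith
      linarith
    nlinarith
  -- conclusion: divide by `K = 3(u+v)`
  have huv : (0 : ℝ) < (u : ℝ) + v := by linarith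
  have hfinal : h + omega ℂ / 3 * ((u : ℝ) / ((u : ℝ) + v)) * Real.log q ≤ Real.log ρ := by
    have e : h + omega ℂ / 3 * ((u : ℝ) / ((u : ℝ) + v)) * Real.log q =
        (L + omega ℂ * u * Real.log q) / K := by
      rw [hL, hK]; field_simp
    rw [e, div_le_iff₀ hK0]
    linarith
  exact hfinal

/-- **Growth of the Kronecker powers of `CW_q`**: `R(CW_q^{⊗N}) = O((q+2)^{(1+ε)N})` for every
`ε > 0` (from `R_3(CW_q) ≤ q + 2`, `BigCoppersmithWinograd.lean`, and BCS Lemma (15.27),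
`BorderRankKronecker.lean`). [cite: BurgisserClausenShokrollahi1997, Lemma (15.27) and p. 384] -/
theorem isBigO_tensorRank_kroneckerPow_bigCwTensor (q : ℕ) {ε : ℝ} (hε : 0 < ε) :
    (fun N : ℕ => (tensorRank (kroneckerPow (bigCwTensor ℂ q) N) : ℝ)) =O[atTop]
      fun N : ℕ => ((q + 2 : ℕ) : ℝ) ^ ((1 + ε) * N) := by
  classical
  exact isBigO_tensorRank_kroneckerPow_of_approxRank_le (approxRank_three_bigCwTensor_le ℂ q)
    (by omega) hε

/-- **The level-1 laser-method bound for `CW_q` (BCS Thm. 15.41, second application, p. 384;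
Coppersmith–Winograd 1990, §7)**: for `q ≥ 2`, `u ≥ 1`, `v ≥ 0` and `β = v/(u+v)`,
`H((1+β)/3, (2-2β)/3, β/3) + (ω/3)(1-β) log q ≤ log (q + 2)`, i.e.
`η((u+2v)/(3(u+v))) + η(2u/(3(u+v))) + η(v/(3(u+v))) + (ω/3)·(u/(u+v))·log q ≤ log(q+2)` with
`η(x) = -x log x` (natural logarithms; the printed `log bR(t)` is `log(q+2)` by the identity of
p. 384, and Ex. 15.24(7) allows the asymptotic rank). [cite: BurgisserClausenShokrollahi1997, Thm. 15.41 and p. 384] -/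
theorem bigCw_laserBound (q : ℕ) (hq : 2 ≤ q) (u v : ℕ) (hu : 1 ≤ u) :
    negMulLog (((u : ℝ) + 2 * v) / (3 * ((u : ℝ) + v))) + negMulLog ((2 * (u : ℝ)) / (3 * ((u : ℝ) + v))) +
        negMulLog ((v : ℝ) / (3 * ((u : ℝ) + v))) +
      omega ℂ / 3 * ((u : ℝ) / ((u : ℝ) + v)) * Real.log q ≤ Real.log ((q : ℝ) + 2) := by
  have h := bigCw_laserBound_of_growth q hq (ρ := ((q + 2 : ℕ) : ℝ)) (by positivity)
    (fun ε hε => isBigO_tensorRank_kroneckerPow_bigCwTensor q hε) u v hu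
  push_cast at h
  exact h

/-- The bound solved for `ω`: for `q ≥ 2`, `u ≥ 1`,
`ω ≤ 3 ((u+v)/u) (log(q+2) − H(P₁)) / log q`. [cite: BurgisserClausenShokrollahi1997, p. 384 ("hence ω ≤ 3 (log(q+2) − H)/((1−β) log q)")] -/
theorem omega_le_bigCw_laserBound (q : ℕ) (hq : 2 ≤ q) (u v : ℕ) (hu : 1 ≤ u) :
    omega ℂ ≤ 3 * (((u : ℝ) + v) / u) *
      (Real.log ((q : ℝ) + 2) - (negMulLog (((u : ℝ) + 2 * v) / (3 * ((u : ℝ) + v))) +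
        negMulLog ((2 * (u : ℝ)) / (3 * ((u : ℝ) + v))) + negMulLog ((v : ℝ) / (3 * ((u : ℝ) + v))))) /
      Real.log q := by
  have h := bigCw_laserBound q hq u v hu
  have hq1 : (1 : ℝ) < q := by exact_mod_cast hq
  have hlogq : 0 < Real.log q := Real.log_pos hq1
  have hu' : (1 : ℝ) ≤ u := by exact_mod_cast hu
  have hv' : (0 : ℝ) ≤ v := Nat.cast_nonneg _
  have hu0 : (0 : ℝ) < u := by linarith
  have huv : (0 : ℝ) < (u : ℝ) + v := by linarith
  rw [le_div_iff₀ hlogq]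
  have e : omega ℂ / 3 * ((u : ℝ) / ((u : ℝ) + v)) * Real.log q =
      omega ℂ * Real.log q / (3 * (((u : ℝ) + v) / u)) := by
    field_simp
  rw [e] at h
  have h3 : (0 : ℝ) < 3 * (((u : ℝ) + v) / u) := by positivity
  have := (div_le_iff₀' h3).1 (by linarith : omega ℂ * Real.log q / (3 * (((u : ℝ) + v) / u)) ≤
    Real.log ((q : ℝ) + 2) - (negMulLog (((u : ℝ) + 2 * v) / (3 * ((u : ℝ) + v))) +
      negMulLog ((2 * (u : ℝ)) / (3 * ((u : ℝ) + v))) + negMulLog ((v : ℝ) / (3 * ((u : ℝ) + v)))))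
  linarith

/-! ## The printed form: the bound as a function of `β` -/

/-- Rational `β ∈ [0,1)` as `β = v/(u+v)` with `u ≥ 1`: the marginal type `((1+β)/3, (2-2β)/3, β/3)`
is `((u+2v), 2u, v)/(3(u+v))` and `1 - β = u/(u+v)`. [folklore] -/
theorem exists_nat_ratio_eq_of_rat (β : ℚ) (h0 : 0 ≤ β) (h1 : β < 1) :
    ∃ u v : ℕ, 1 ≤ u ∧ ((u : ℝ) + 2 * v) / (3 * ((u : ℝ) + v)) = (1 + (β : ℝ)) / 3 ∧
      (2 * (u : ℝ)) / (3 * ((u : ℝ) + v)) = (2 - 2 * (β : ℝ)) / 3 ∧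
      (v : ℝ) / (3 * ((u : ℝ) + v)) = (β : ℝ) / 3 ∧ (u : ℝ) / ((u : ℝ) + v) = 1 - (β : ℝ) := by
  have hnum : 0 ≤ β.num := Rat.num_nonneg.2 h0
  have hlt : β.num < β.den := Rat.num_lt_denom_iff.2 h1
  set n : ℕ := β.num.toNat with hn
  have hn' : (n : ℤ) = β.num := Int.toNat_of_nonneg hnum
  have hnd : n < β.den := by omega
  refine ⟨β.den - n, n, by omega, ?_⟩
  have hβ : (β : ℝ) = (n : ℝ) / (β.den : ℝ) := by
    rw [Rat.cast_def]
    congr 1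
    exact_mod_cast hn'.symm
  have hd : (0 : ℝ) < β.den := by exact_mod_cast β.den_pos
  have hsub : (((β.den - n : ℕ)) : ℝ) = (β.den : ℝ) - n := by
    rw [Nat.cast_sub hnd.le]
  rw [hsub, hβ]
  refine ⟨?_, ?_, ?_, ?_⟩ <;> field_simp <;> ring

/-- **BCS p. 384 / CW 1990 §7, as printed, for rational `β`**: for `q ≥ 2` and `β ∈ [0,1) ∩ ℚ`,
`H(β/3, (2−2β)/3, (1+β)/3) + (ω/3)(1−β) log q ≤ log(q+2)` (nats; BCS display:
`H(β/3, (2-2β)/3, (1+β)/3) + (ω/2)(β log 1 + (1-β) log q^{2/3}) ≤ log(q+2)`).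
[cite: BurgisserClausenShokrollahi1997, Thm. 15.41 and p. 384] -/
theorem bigCw_laserBound_rat (q : ℕ) (hq : 2 ≤ q) (β : ℚ) (h0 : 0 ≤ β) (h1 : β < 1) :
    negMulLog ((1 + (β : ℝ)) / 3) + negMulLog ((2 - 2 * (β : ℝ)) / 3) + negMulLog ((β : ℝ) / 3) +
      omega ℂ / 3 * (1 - (β : ℝ)) * Real.log q ≤ Real.log ((q : ℝ) + 2) := by
  obtain ⟨u, v, hu, e0, e1, e2, e3⟩ := exists_nat_ratio_eq_of_rat β h0 h1
  have h := bigCw_laserBound q hq u v hu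
  rw [e0, e1, e2, e3] at h
  exact h

/-- **BCS p. 384 / CW 1990 §7, as printed, for real `β ∈ [0,1)`**: for `q ≥ 2`,
`H(β/3, (2−2β)/3, (1+β)/3) + (ω/3)(1−β) log q ≤ log(q+2)` (by density of `ℚ` and continuity of
the left-hand side in `β`; BCS: "by an easy continuity argument").
[cite: BurgisserClausenShokrollahi1997, Thm. 15.41 and p. 384] -/
theorem bigCw_laserBound_real (q : ℕ) (hq : 2 ≤ q) {β : ℝ} (h0 : 0 ≤ β) (h1 : β < 1) :
    negMulLog ((1 + β) / 3) + negMulLog ((2 - 2 * β) / 3) + negMulLog (β / 3) +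
      omega ℂ / 3 * (1 - β) * Real.log q ≤ Real.log ((q : ℝ) + 2) := by
  obtain ⟨F, hF⟩ : ∃ F : ℝ → ℝ, F = fun x => negMulLog ((1 + x) / 3) + negMulLog ((2 - 2 * x) / 3) +
      negMulLog (x / 3) + omega ℂ / 3 * (1 - x) * Real.log q := ⟨_, rfl⟩
  have hFc : Continuous F := by
    rw [hF]
    have hc := continuous_negMulLog
    exact (((hc.comp (by fun_prop)).add (hc.comp (by fun_prop))).add (hc.comp (by fun_prop))).add
      (by fun_prop)
  -- rational approximants `β < r n < min 1 (β + 1/(n+1))`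
  have hr : ∀ n : ℕ, ∃ r : ℚ, β < r ∧ (r : ℝ) < min 1 (β + 1 / ((n : ℝ) + 1)) := fun n =>
    exists_rat_btwn (lt_min h1 (by linarith [show (0 : ℝ) < 1 / ((n : ℝ) + 1) by positivity]))
  choose r hr1 hr2 using hr
  have hlim : Tendsto (fun n => (r n : ℝ)) atTop (𝓝 β) := by
    have hup : Tendsto (fun n : ℕ => β + 1 / ((n : ℝ) + 1)) atTop (𝓝 β) := by
      have := tendsto_const_nhds (x := β) (f := (atTop : Filter ℕ)) |>.add
        tendsto_one_div_add_atTop_nhds_zero_nat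
      simpa using this
    exact tendsto_of_tendsto_of_tendsto_of_le_of_le tendsto_const_nhds hup (fun n => (hr1 n).le)
      fun n => (hr2 n).le.trans (min_le_right _ _)
  have hFn : ∀ n, F (r n) ≤ Real.log ((q : ℝ) + 2) := fun n => by
    have h0n : (0 : ℚ) ≤ r n := by exact_mod_cast (h0.trans (hr1 n).le : (0 : ℝ) ≤ r n)
    have h1n : r n < 1 := by exact_mod_cast ((hr2 n).trans_le (min_le_left _ _) : ((r n : ℚ) : ℝ) < 1)
    rw [hF]
    exact bigCw_laserBound_rat q hq (r n) h0n h1n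
  have hle := le_of_tendsto' ((hFc.tendsto β).comp hlim) fun n => hFn n
  rw [hF] at hle
  exact hle

end Main

end Literature.Computability.AlgebraicComplexity

end
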